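import Summits.BirchSwinnertonDyer.BirchSwinnertonDyer.Theorems.GenusKolyvaginAtTwoShaCardDvdPowAtTwoRTOnCut
import Summits.BirchSwinnertonDyer.BirchSwinnertonDyer.Theorems.GenusKolyvaginAtTwoPowDvdShaCardAtTwoRT
import Summits.BirchSwinnertonDyer.BirchSwinnertonDyer.Theorems.GenusKolyvaginAtTwoEquivariantChebotarevAtTwoR
import Summits.BirchSwinnertonDyer.BirchSwinnertonDyer.Theorems.GenusKolyvaginAtTwoCyclicTorsionOfNegDisc
import HarnessLib

/-!
# Route `GenusKolyvaginAtTwo`, Q3R_T′ `EquivariantKolyvaginExactAtTwoRT` (rev 39: stmt-BirchSwinnertonDyer-23468) / U_T′ (stmt-23469), LINE 19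
# `rational_pair_descent` — THE ℚ-SIDE EXACT ORDER ON THE CUT: **`#Ш(E/ℚ)[2^∞] = 2^(2M₀)`** (not only `∣`), from PAIRCOUNT + SANDWICH′ + L_T

Seat `bsd-line-gk2-p4` g23 (WIDTH-5 attach, cell `bsd-f1-sign2`), `--supports stmt-BirchSwinnertonDyer-23468 --as helper`.
THEOREMS ONLY (no definition, no named fact, no `sorry`).  BSD is NOT proved by any of this; the items 23468/23469 are closed by the LEAD's
files, not by this one; nothing is closed here.

WHAT.  On Q3R_T′'s frame VERBATIM (U_T's habitat: `E/ℚ` globally minimal, non-CM, odd Tamagawa product, an odd multiplicative prime, `Δ < 0`,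
`ρ_{E,2^n}` onto; `K` imaginary quadratic, `d_K` odd `≠ −3`, Heegner, the two non-square side conditions; `y_K = P(1)` non-torsion with
`2^{M₀} ∥` its divisibility; the cut `w(E) = +1`, a globally minimal `Wd ≅ E^{(d_K)}` with `#Sel₂(Wd) = 2` and `ord₂ c(Wd) ≤ 1`; and L_T's
Gross-deep Kolyvagin witness `(n) (d) hn hKoly hPn`), modulo the in-signature antecedents Q2 / Q5R / Q1-shape:
* §1 `natCard_primaryComponent_sha_rat_two_eq_pow_onCut` — **`#Ш(E/ℚ)[2^∞] = 2^(2M₀)`**.  Mechanism (four landed theorems, pure arithmetic here):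
  PAIRCOUNT `stub_shaRatCardDvdOfMinimalTwin` (gk2-p4 g22, p749270): `#Ш(E/ℚ)[2^∞] ∣ 4^{M₀}`; SANDWICH′ `stub_sandwichOfMinimalTwin` (LEAD gk2-p1
  g19, p750599): `#Ш(E/K)[2^∞] ∣ 2·#Ш(E/ℚ)[2^∞]`; L_T `Theorems.powDvdShaCardAtTwoRT_proof` (gk2-p4 g21, p744020): `4^{M₀} ∣ #Ш(E/K)[2^∞]`;
  Cassels–Tate squareness over `ℚ` `exists_natCard_primaryComponent_sha_rat_two_eq_pow_two_mul_onHabitat` (gk2-p5 g29): `#Ш(E/ℚ)[2^∞] = 4^t`.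
  Hence `4^{M₀} ∣ 2·4^t ∣ 2·4^{M₀}`, i.e. `2M₀ ≤ 2t + 1 ≤ 2M₀ + 1`, so `t = M₀`: the slack bit of SANDWICH′ is refunded by squareness OVER `ℚ`
  (the LEAD's `…RTOnCut` refunds it by squareness over `K` to get U_T′; this file reads the same sandwich from below with L_T).
* §2 `natCard_primaryComponent_sha_rat_two_eq_pow_onCut_of_kolyvaginRelation` — the same with Q5R `EquivariantChebotarevAtTwoR` and the
  Q1-shape clause DISCHARGED by their tree proofs (`GenusExact.equivariantChebotarevAtTwoR_proof`, `GenusCyclicTorsion.cyclicTorsionOfNegDisc_proof`):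
  conditional on Q2 `KolyvaginRelationAtTwo` alone (= print fact `prop37_2`).
* §3 `natCard_primaryComponent_sha_rat_two_eq_baseChange_onCut` — **`#Ш(E/ℚ)[2^∞] = #Ш(E/K)[2^∞]`** on the cut (both `= 4^{M₀}`: §1 and
  `Nat.dvd_antisymm` of the LEAD's `shaCardDvdPowAtTwoRT_onCut` with L_T).
WHY (consumers).  (i) The route pen's PER-CELL B2Q instrument (`pub/ideators/bsd-idea-1/b2q/PERCELL-B2Q-g21.md`): on a cell of the LIVE
configuration that carries L_T's deep witness, §2 gives the exact 2-part of `#Ш(E/ℚ)` WITHOUT the 2-descent/Cassels-pairing datum (`ellrank` s = 0)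
and for EVERY `g = v₂(Ш_an)` — in particular the `g = 6` cells, where exponent `∣ 8` + `s = 0` left `{16, 64}` undecided (memo §3 BOUND4^3); the
price is the deep Kolyvagin witness of L_T (supply crux 23467) instead of an 8-descent.  (ii) Structure: with (CTQ) `Ш(E/ℚ)[2^∞] ≅ (ℤ/2^{t′})²`
(gk2-p5 g29) this pins `t′ = M₀`, i.e. `Ш(E/ℚ)[2^∞] ≅ (ℤ/2^{M₀})²` on the cut — Kolyvagin's bound B₂ is SHARP there.
BSD is NOT proved by any of this (the relation `4^{M₀} = (L(E,1)/Ω_E)_2` is Gross–Zagier + BSD₂ of the twin, route items hGZ/hTw/22138).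

References: [McCallumLMS1991] §5 Thm. 5.4, Cor. 5.6, Prop. 5.2; [Kolyvagin1989Izv] Thm. B₂; [Kolyvagin1991MathAnn] Thm. 1; [GrossLMS1991] §1
Thm. 1.3, §10; [Kramer1981] Thm. 1; [Cassels1962ArithmeticIV] Thm. 1.1.
-/

set_option autoImplicit false
-- the Theorems namespace of this sub repeats the summit name by design (D-0017 nested layout)
set_option linter.dupNamespace false

noncomputable section

open scoped Classical

namespace Summit.BirchSwinnertonDyer.BirchSwinnertonDyer.Theorems.GenusExact.RationalPairDescent

open WeierstrassCurve NumberField IsDedekindDomain Field Literature.NumberTheory.EllipticCurves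
  Literature.NumberTheory.GaloisRepresentations Literature.NumberTheory.EllipticCurves.ModularForms
open Literature.NumberTheory
open Summit.BirchSwinnertonDyer.BirchSwinnertonDyer.Theses.GenusKolyvaginAtTwo
open Summit.BirchSwinnertonDyer.BirchSwinnertonDyer.Theorems.GenusExact.PlusDescent

/-! ## §1 `#Ш(E/ℚ)[2^∞] = 4^M₀` on Q3R_T′'s frame -/

/-- **THE ℚ-SIDE EXACT ORDER ON THE CUT: `#Ш(E/ℚ)[2^∞] = 2^(2M₀)`** — binders = Q3R_T′ `EquivariantKolyvaginExactAtTwoRT` (rev 39,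
stmt-BirchSwinnertonDyer-23468) VERBATIM, conclusion about `Ш(E/ℚ)` instead of `Ш(E/K)`.  PAIRCOUNT (`∣ 4^M₀`) from above; L_T ∘ SANDWICH′
(`4^M₀ ∣ #Ш(E/K)[2^∞] ∣ 2·#Ш(E/ℚ)[2^∞]`) from below; Cassels–Tate squareness over `ℚ` refunds the slack bit.
[cite: McCallumLMS1991, §5 Thm. 5.4, Cor. 5.6] [cite: Kolyvagin1991MathAnn, Thm. 1] [cite: Kramer1981, Thm. 1] [cite: Cassels1962ArithmeticIV, Thm. 1.1] -/
theorem natCard_primaryComponent_sha_rat_two_eq_pow_onCut :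
    KolyvaginRelationAtTwo → EquivariantChebotarevAtTwoR → (∀ (W : WeierstrassCurve ℚ) [W.IsElliptic], W.Δ < 0 → ∀ (c₀ : Field.absoluteGaloisGroup ℚ), Literature.NumberTheory.GaloisRepresentations.IsComplexConjugation (Rat.castHom ℝ) c₀ → ∀ (M : ℕ), ∃ P : W.geomTorsion ((2 ^ M : ℕ) : ℤ), ∀ Q : W.geomTorsion ((2 ^ M : ℕ) : ℤ), ∃ a b : ℤ, Q = a • P + b • (c₀ • P)) → ∀ (W : WeierstrassCurve ℚ) [W.IsElliptic] [W.IsGloballyMinimal] [NeZero (W.conductorNorm ℤ)], ¬ W.HasCM → Odd W.tamagawaProduct → ∀ (v : IsDedekindDomain.HeightOneSpectrum (NumberField.RingOfIntegers ℚ)), ((2 : ℕ) : NumberField.RingOfIntegers ℚ) ∉ v.asIdeal → ((W.conductorNorm ℤ : ℕ) : NumberField.RingOfIntegers ℚ) ∈ v.asIdeal → W.HasMultiplicativeReductionAt v → W.Δ < 0 → ∀ (K : Type) [Field K] [NumberField K], Literature.NumberTheory.EllipticCurves.IsImaginaryQuadratic K → Odd (NumberField.discr K) → NumberField.discr K ≠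 -3 → Literature.NumberTheory.EllipticCurves.SatisfiesHeegnerHypothesis (W.conductorNorm ℤ) K → ¬ IsSquare ((NumberField.discr K : ℚ) * -|W.Δ|) → ¬ IsSquare ((NumberField.discr K : ℚ) * (-(2 * |W.Δ|))) → (∀ n : ℕ, 0 < n → W.HasSurjectiveModNGaloisRep ((2 : ℤ) ^ n)) → ∀ (Dt : Literature.NumberTheory.EllipticCurves.ModularForms.ModularParametrizationData W (W.conductorNorm ℤ)) (β : ℤ) (ι : K →+* ℂ) (d₁ : Literature.NumberTheory.EllipticCurves.KolyvaginHeegnerData Dt β ι 1), ¬ IsOfFinAddOrder d₁.derivedPoint → ∀ (M₀ : ℕ), (∃ Q : (W.baseChange (Literature.NumberTheory.EllipticCurves.ringClassField K ι 1)).toAffine.Point, ((2 ^ M₀ : ℕ) : ℤ) • Q = d₁.derivedPoint) → (¬ ∃ Q : (W.baseChange (Literature.NumberTheory.EllipticCurves.ringClassField K ι 1)).toAffine.Point, ((2 ^ (M₀ + 1) : ℕ) : ℤ) • Q = d₁.derivedPoint) → W.rootNumber = 1 → ∀ (Wd : WeierstrassCurve ℚ) [Wd.IsElliptic] [Wd.IsGloballyMinimal],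 (∃ C : WeierstrassCurve.VariableChange ℚ, C • W.quadraticTwist (NumberField.discr K : ℚ) = Wd) → Nat.card (Wd.selmerGroup 2) = 2 → padicValNat 2 Wd.tamagawaProduct ≤ 1 → ∀ (n : ℕ) (d : Literature.NumberTheory.EllipticCurves.KolyvaginHeegnerData Dt β ι n), Squarefree n → (∀ ℓ ∈ n.primeFactors, Literature.NumberTheory.EllipticCurves.Zhang2014.IsKolyvaginPrime (W.conductorNorm ℤ) W K 2 ℓ ∧ 2 ≤ Literature.NumberTheory.EllipticCurves.Zhang2014.kolyvaginIndex W 2 ℓ ∧ Literature.NumberTheory.EllipticCurves.FrobEqFrobInfty W K 2 ℓ) → (¬ ∃ Q : (W.baseChange (Literature.NumberTheory.EllipticCurves.ringClassField K ι n)).toAffine.Point, (2 : ℤ) • Q = d.derivedPoint) → Nat.card (AddCommGroup.primaryComponent W.sha 2) = 2 ^ (2 * M₀) := by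
  intro hQ2 hQ5R hQ1 W _ _ _ hcm hT v h2v hNv hmult hneg K _ _ hIQ hodd h3 hHe hsq1 hsq2 hρ Dt β ι d₁ hy M₀ hdiv hndiv hw Wd _ _ hWd hSel hDEF n d hn hKoly hPn
  -- from above: PAIRCOUNT
  have hpair := stub_shaRatCardDvdOfMinimalTwin hQ2 hQ5R hQ1 W hcm hT v h2v hNv hmult hneg K hIQ hodd h3 hHe hsq1 hsq2 hρ Dt β ι d₁ hy
    M₀ hdiv hndiv hw Wd hWd hSel hDEF
  -- from below: L_T, then SANDWICH′
  have hL := Summit.BirchSwinnertonDyer.BirchSwinnertonDyer.Theorems.powDvdShaCardAtTwoRT_proof hQ2 hQ5R hQ1 W hcm hT v h2v hNv hmult hneg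
    K hIQ hodd h3 hHe hsq1 hsq2 hρ Dt β ι d₁ hy M₀ hdiv hndiv n d hn hKoly hPn
  have hsand := stub_sandwichOfMinimalTwin hQ2 hQ5R hQ1 W hcm hT v h2v hNv hmult hneg K hIQ hodd h3 hHe hsq1 hsq2 hρ Dt β ι d₁ hy
    M₀ hdiv hndiv hw Wd hWd hSel hDEF
  -- squareness over `ℚ`
  obtain ⟨t, ht⟩ := exists_natCard_primaryComponent_sha_rat_two_eq_pow_two_mul_onHabitat hQ2 W hcm hT v h2v hNv hmult hneg K hIQ hodd h3
    hHe hsq1 hsq2 hρ Dt β ι d₁ M₀ hndiv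
  rw [ht] at hpair hsand ⊢
  have hlow : 2 ^ (2 * M₀) ∣ 2 * 2 ^ (2 * t) := hL.trans hsand
  rw [show 2 * 2 ^ (2 * t) = 2 ^ (2 * t + 1) by ring] at hlow
  have h₁ : 2 * M₀ ≤ 2 * t + 1 := (Nat.pow_dvd_pow_iff_le_right (by norm_num)).mp hlow
  have h₂ : 2 * t ≤ 2 * M₀ := (Nat.pow_dvd_pow_iff_le_right (by norm_num)).mp hpair
  congr 1
  omega

/-! ## §2 The same, conditional on Q2 alone -/

/-- **`#Ш(E/ℚ)[2^∞] = 2^(2M₀)` on the cut, modulo Q2 `KolyvaginRelationAtTwo` only** — §1 with Q5R `EquivariantChebotarevAtTwoR` and the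
Q1-shape clause fed by their tree proofs (`GenusExact.equivariantChebotarevAtTwoR_proof`, `GenusCyclicTorsion.cyclicTorsionOfNegDisc_proof`);
explicit binders.  The per-cell reading: a cell of the live configuration with a Gross-deep witness `(n, d)` (`P(n) ∉ 2E(K[n])`) has
`#Ш(E/ℚ)[2^∞] = 4^M₀` — no 2-descent datum needed. [cite: McCallumLMS1991, §5 Thm. 5.4] [cite: Kolyvagin1991MathAnn, Thm. 1] [cite: GrossLMS1991, §10] -/
theorem natCard_primaryComponent_sha_rat_two_eq_pow_onCut_of_kolyvaginRelation (hQ2 : KolyvaginRelationAtTwo)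
    (W : WeierstrassCurve ℚ) [W.IsElliptic] [W.IsGloballyMinimal] [NeZero (W.conductorNorm ℤ)] (hcm : ¬ W.HasCM)
    (hT : Odd W.tamagawaProduct) (v : HeightOneSpectrum (𝓞 ℚ)) (h2v : ((2 : ℕ) : 𝓞 ℚ) ∉ v.asIdeal)
    (hNv : ((W.conductorNorm ℤ : ℕ) : 𝓞 ℚ) ∈ v.asIdeal) (hmult : W.HasMultiplicativeReductionAt v) (hneg : W.Δ < 0)
    (K : Type) [Field K] [NumberField K] (hIQ : IsImaginaryQuadratic K) (hodd : Odd (NumberField.discr K))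
    (h3 : NumberField.discr K ≠ -3) (hHe : SatisfiesHeegnerHypothesis (W.conductorNorm ℤ) K)
    (hsq1 : ¬ IsSquare ((NumberField.discr K : ℚ) * -|W.Δ|)) (hsq2 : ¬ IsSquare ((NumberField.discr K : ℚ) * (-(2 * |W.Δ|))))
    (hρ : ∀ n : ℕ, 0 < n → W.HasSurjectiveModNGaloisRep ((2 : ℤ) ^ n))
    (Dt : ModularParametrizationData W (W.conductorNorm ℤ)) (β : ℤ) (ι : K →+* ℂ) (d₁ : KolyvaginHeegnerData Dt β ι 1)
    (hy : ¬ IsOfFinAddOrder d₁.derivedPoint) (M₀ : ℕ)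
    (hdiv : ∃ Q : (W.baseChange (ringClassField K ι 1)).toAffine.Point, ((2 ^ M₀ : ℕ) : ℤ) • Q = d₁.derivedPoint)
    (hndiv : ¬ ∃ Q : (W.baseChange (ringClassField K ι 1)).toAffine.Point, ((2 ^ (M₀ + 1) : ℕ) : ℤ) • Q = d₁.derivedPoint)
    (hw : W.rootNumber = 1) (Wd : WeierstrassCurve ℚ) [Wd.IsElliptic] [Wd.IsGloballyMinimal]
    (hWd : ∃ C : VariableChange ℚ, C • W.quadraticTwist (NumberField.discr K : ℚ) = Wd)
    (hSel : Nat.card (Wd.selmerGroup 2) = 2) (hDEF : padicValNat 2 Wd.tamagawaProduct ≤ 1)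
    (n : ℕ) (d : KolyvaginHeegnerData Dt β ι n) (hn : Squarefree n)
    (hKoly : ∀ ℓ ∈ n.primeFactors, Zhang2014.IsKolyvaginPrime (W.conductorNorm ℤ) W K 2 ℓ ∧ 2 ≤ Zhang2014.kolyvaginIndex W 2 ℓ ∧
      FrobEqFrobInfty W K 2 ℓ)
    (hPn : ¬ ∃ Q : (W.baseChange (ringClassField K ι n)).toAffine.Point, (2 : ℤ) • Q = d.derivedPoint) :
    Nat.card (AddCommGroup.primaryComponent W.sha 2) = 2 ^ (2 * M₀) :=
  natCard_primaryComponent_sha_rat_two_eq_pow_onCut hQ2 GenusExact.equivariantChebotarevAtTwoR_proof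
    GenusCyclicTorsion.cyclicTorsionOfNegDisc_proof W hcm hT v h2v hNv hmult hneg K hIQ hodd h3 hHe hsq1 hsq2 hρ Dt β ι d₁ hy M₀ hdiv hndiv
    hw Wd hWd hSel hDEF n d hn hKoly hPn

/-! ## §3 `Ш(E/ℚ)[2^∞]` and `Ш(E/K)[2^∞]` have the same order on the cut -/

/-- **`#Ш(E/ℚ)[2^∞] = #Ш(E/K)[2^∞]` on Q3R_T′'s frame** — both equal `4^M₀`: §1, and `Nat.dvd_antisymm` of the LEAD's U_T-on-the-cut
`shaCardDvdPowAtTwoRT_onCut` with L_T `powDvdShaCardAtTwoRT_proof`.  (Restriction `Ш(E/ℚ)[2^∞] → Ш(E/K)[2^∞]` has kernel of order `≤ 2` and, on the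
cut, `τ`-coinvariants of order `≤ 2`; the two slack bits cancel exactly — the numerical shadow of LEAD memo R7 §1.)
[cite: Kramer1981, Thm. 1] [cite: GrossLMS1991, §1 Thm. 1.3] [cite: McCallumLMS1991, §5 Thm. 5.4] -/
theorem natCard_primaryComponent_sha_rat_two_eq_baseChange_onCut :
    KolyvaginRelationAtTwo → EquivariantChebotarevAtTwoR → (∀ (W : WeierstrassCurve ℚ) [W.IsElliptic], W.Δ < 0 → ∀ (c₀ : Field.absoluteGaloisGroup ℚ), Literature.NumberTheory.GaloisRepresentations.IsComplexConjugation (Rat.castHom ℝ) c₀ → ∀ (M : ℕ), ∃ P : W.geomTorsion ((2 ^ M : ℕ) : ℤ), ∀ Q : W.geomTorsion ((2 ^ M : ℕ) : ℤ), ∃ a b : ℤ, Q = a • P + b • (c₀ • P)) → ∀ (W : WeierstrassCurve ℚ) [W.IsElliptic] [W.IsGloballyMinimal] [NeZero (W.conductorNorm ℤ)], ¬ W.HasCM → Odd W.tamagawaProduct → ∀ (v : IsDedekindDomain.HeightOneSpectrum (NumberField.RingOfIntegers ℚ)), ((2 : ℕ) : NumberField.RingOfIntegers ℚ) ∉ v.asIdeal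 → ((W.conductorNorm ℤ : ℕ) : NumberField.RingOfIntegers ℚ) ∈ v.asIdeal → W.HasMultiplicativeReductionAt v → W.Δ < 0 → ∀ (K : Type) [Field K] [NumberField K], Literature.NumberTheory.EllipticCurves.IsImaginaryQuadratic K → Odd (NumberField.discr K) → NumberField.discr K ≠ -3 → Literature.NumberTheory.EllipticCurves.SatisfiesHeegnerHypothesis (W.conductorNorm ℤ) K → ¬ IsSquare ((NumberField.discr K : ℚ) * -|W.Δ|) → ¬ IsSquare ((NumberField.discr K : ℚ) * (-(2 * |W.Δ|))) → (∀ n : ℕ, 0 < n → W.HasSurjectiveModNGaloisRep ((2 : ℤ) ^ n)) → ∀ (Dt : Literature.NumberTheory.EllipticCurves.ModularForms.ModularParametrizationData W (W.conductorNorm ℤ)) (β : ℤ) (ι : K →+* ℂ) (d₁ : Literature.NumberTheory.EllipticCurves.KolyvaginHeegnerData Dt β ι 1), ¬ IsOfFinAddOrder d₁.derivedPoint → ∀ (M₀ : ℕ), (∃ Q : (W.baseChange (Literature.NumberTheory.EllipticCurves.ringClassField K ι 1)).toAffine.Point, ((2 ^ M₀ : ℕ) : ℤ) • Q = d₁.derivedPoint)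 → (¬ ∃ Q : (W.baseChange (Literature.NumberTheory.EllipticCurves.ringClassField K ι 1)).toAffine.Point, ((2 ^ (M₀ + 1) : ℕ) : ℤ) • Q = d₁.derivedPoint) → W.rootNumber = 1 → ∀ (Wd : WeierstrassCurve ℚ) [Wd.IsElliptic] [Wd.IsGloballyMinimal], (∃ C : WeierstrassCurve.VariableChange ℚ, C • W.quadraticTwist (NumberField.discr K : ℚ) = Wd) → Nat.card (Wd.selmerGroup 2) = 2 → padicValNat 2 Wd.tamagawaProduct ≤ 1 → ∀ (n : ℕ) (d : Literature.NumberTheory.EllipticCurves.KolyvaginHeegnerData Dt β ι n), Squarefree n → (∀ ℓ ∈ n.primeFactors, Literature.NumberTheory.EllipticCurves.Zhang2014.IsKolyvaginPrime (W.conductorNorm ℤ) W K 2 ℓ ∧ 2 ≤ Literature.NumberTheory.EllipticCurves.Zhang2014.kolyvaginIndex W 2 ℓ ∧ Literature.NumberTheory.EllipticCurves.FrobEqFrobInfty W K 2 ℓ) → (¬ ∃ Q : (W.baseChange (Literature.NumberTheory.EllipticCurves.ringClassField K ι n)).toAffine.Point, (2 : ℤ) • Q = d.derivedPoint) → Nat.card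 (AddCommGroup.primaryComponent W.sha 2) = Nat.card (AddCommGroup.primaryComponent (W.baseChange K).sha 2) := by
  intro hQ2 hQ5R hQ1 W _ _ _ hcm hT v h2v hNv hmult hneg K _ _ hIQ hodd h3 hHe hsq1 hsq2 hρ Dt β ι d₁ hy M₀ hdiv hndiv hw Wd _ _ hWd hSel hDEF n d hn hKoly hPn
  rw [natCard_primaryComponent_sha_rat_two_eq_pow_onCut hQ2 hQ5R hQ1 W hcm hT v h2v hNv hmult hneg K hIQ hodd h3 hHe hsq1 hsq2 hρ Dt β ι d₁
    hy M₀ hdiv hndiv hw Wd hWd hSel hDEF n d hn hKoly hPn]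
  exact (Nat.dvd_antisymm
    (shaCardDvdPowAtTwoRT_onCut hQ2 hQ5R hQ1 W hcm hT v h2v hNv hmult hneg K hIQ hodd h3 hHe hsq1 hsq2 hρ Dt β ι d₁ hy M₀ hdiv hndiv hw
      Wd hWd hSel hDEF)
    (Summit.BirchSwinnertonDyer.BirchSwinnertonDyer.Theorems.powDvdShaCardAtTwoRT_proof hQ2 hQ5R hQ1 W hcm hT v h2v hNv hmult hneg K hIQ
      hodd h3 hHe hsq1 hsq2 hρ Dt β ι d₁ hy M₀ hdiv hndiv n d hn hKoly hPn)).symm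

end Summit.BirchSwinnertonDyer.BirchSwinnertonDyer.Theorems.GenusExact.RationalPairDescent

end
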